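import Summits.Ventures.PercRepro.Night2NearFatReduce

/-!
# night-2: THE LINES OF `W` THROUGH THE BASIS — packing (gen 40)

The non-suspect family theorem (Night2NearFatFair) asks for two sets `ℓ₁, ℓ₂` covering every LONG basis line and two sets
`C₁, C₂` covering every LONG line through a basis point.  Two ingredients:
* **geometry**: the `W`-parts of two basis lines `cl {a, b}`, `cl {c, d}` sharing a point of `W` coincide
  (`clF_pair_eq_of_mem_of_mem`: submodularity on the two lines against the independent basis), and two lines through basis
  points sharing two points of `W` coincide (`clF_eq_of_two_mem_inter`: the two points span both lines);
* **packing**: a family of pairwise disjoint subsets of `W` with `≥ m` points each has at most two members when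
  `|W| < 3m` (`exists_two_cover_of_pairwise_disjoint`); a family of subsets pairwise sharing `≤ 1` point with `≥ m` points
  each has at most two members when `|W| + 3 < 3m` (`exists_two_cover_of_pairwise_inter_le_one`) and at most one when
  `|W| + 1 < 2m` (`exists_one_cover_of_pairwise_inter_le_one`).
Paper: proofs/NIGHT-2-g40.md §4.
-/

namespace PercRepro.Shadow

open PercRepro.ThmH PercRepro.PerFlat

variable {α : Type*} [DecidableEq α] {M : Matroid α} [M.Finite] {G : Finset α}

/-- Two distinct points of `gr M` span a rank-2 set whose closure is any line containing both. -/
theorem clF_pair_eq_of_subset_clF_pair (hs : ∀ e ∈ gr M, ∀ f ∈ gr M, e ≠ f → rkN M {e, f} = 2)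
    {a b w w' : α} (ha : a ∈ gr M) (hb : b ∈ gr M) (hw : w ∈ gr M) (hw' : w' ∈ gr M) (hab : a ≠ b) (hww' : w ≠ w')
    (hwab : w ∈ clF M {a, b}) (hw'ab : w' ∈ clF M {a, b}) : clF M {w, w'} = clF M {a, b} := by
  have hpair : ({a, b} : Finset α) ⊆ gr M := by
    intro e he
    rw [Finset.mem_insert, Finset.mem_singleton] at he
    rcases he with rfl | rfl
    · exact ha
    · exact hb
  have hsub : ({w, w'} : Finset α) ⊆ clF M {a, b} := by
    intro e he
    rw [Finset.mem_insert, Finset.mem_singleton] at he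
    rcases he with rfl | rfl
    · exact hwab
    · exact hw'ab
  apply clF_eq_clF_of_subset_clF_of_rkN_le hpair hsub
  rw [hs a ha b hb hab, hs w hw w' hw' hww']

/-- **Two lines through basis points sharing two points of `W` coincide.** -/
theorem clF_eq_of_two_mem_inter (hs : ∀ e ∈ gr M, ∀ f ∈ gr M, e ≠ f → rkN M {e, f} = 2)
    {a y a' y' w w' : α} (ha : a ∈ gr M) (hy : y ∈ gr M) (ha' : a' ∈ gr M) (hy' : y' ∈ gr M) (hw : w ∈ gr M)
    (hw' : w' ∈ gr M) (hay : a ≠ y) (hay' : a' ≠ y') (hww' : w ≠ w') (hw1 : w ∈ clF M {a, y}) (hw1' : w' ∈ clF M {a, y})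
    (hw2 : w ∈ clF M {a', y'}) (hw2' : w' ∈ clF M {a', y'}) : clF M {a, y} = clF M {a', y'} := by
  rw [← clF_pair_eq_of_subset_clF_pair hs ha hy hw hw' hay hww' hw1 hw1',
    ← clF_pair_eq_of_subset_clF_pair hs ha' hy' hw hw' hay' hww' hw2 hw2']

/-- **Two basis lines sharing a point of `W` coincide**: for an independent `Q′ ∌ w` the two lines `cl {a, b}` and
`cl {c, d}` either have `c, d ∈ cl {a, b}` (equal lines) or meet in a flat of rank `≤ 1` (submodularity against
`rk ≥ 3`), which cannot contain `w` together with a basis point `a` or `b` of `cl {c, d}`, nor `w` alone when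
`{a, b, c, d}` has rank `4`. -/
theorem clF_pair_eq_of_mem_of_mem (hs : ∀ e ∈ gr M, ∀ f ∈ gr M, e ≠ f → rkN M {e, f} = 2)
    (hl : ∀ e ∈ gr M, M.Indep {e}) {Q' : Finset α} (hQg : Q' ⊆ gr M) (hind : M.Indep (Q' : Set α))
    {a b c d : α} (ha : a ∈ Q') (hb : b ∈ Q') (hc : c ∈ Q') (hd : d ∈ Q') (hab : a ≠ b) (hcd : c ≠ d)
    {w : α} (hw : w ∈ gr M) (hwQ : w ∉ Q') (hw1 : w ∈ clF M {a, b}) (hw2 : w ∈ clF M {c, d}) :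
    clF M {a, b} = clF M {c, d} := by
  have hpair : ∀ u v : α, u ∈ Q' → v ∈ Q' → ({u, v} : Finset α) ⊆ gr M := by
    intro u v hu hv e he
    rw [Finset.mem_insert, Finset.mem_singleton] at he
    rcases he with rfl | rfl
    · exact hQg hu
    · exact hQg hv
  have hF₁g : clF M {a, b} ⊆ gr M := fun v hv => mem_gr_of_mem_clF hv
  have hF₂g : clF M {c, d} ⊆ gr M := fun v hv => mem_gr_of_mem_clF hv
  have hcF₂ : c ∈ clF M {c, d} := subset_clF_of_subset_gr (hpair _ _ hc hd) (Finset.mem_insert_self _ _)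
  have hdF₂ : d ∈ clF M {c, d} :=
    subset_clF_of_subset_gr (hpair _ _ hc hd) (Finset.mem_insert_of_mem (Finset.mem_singleton_self _))
  have haF₁ : a ∈ clF M {a, b} := subset_clF_of_subset_gr (hpair _ _ ha hb) (Finset.mem_insert_self _ _)
  have hbF₁ : b ∈ clF M {a, b} :=
    subset_clF_of_subset_gr (hpair _ _ ha hb) (Finset.mem_insert_of_mem (Finset.mem_singleton_self _))
  by_cases hboth : c ∈ clF M {a, b} ∧ d ∈ clF M {a, b}
  · symm
    apply clF_eq_clF_of_subset_clF_of_rkN_le (hpair _ _ ha hb)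
    · intro e he
      rw [Finset.mem_insert, Finset.mem_singleton] at he
      rcases he with rfl | rfl
      · exact hboth.1
      · exact hboth.2
    · rw [hs a (hQg ha) b (hQg hb) hab, hs c (hQg hc) d (hQg hd) hcd]
  · exfalso
    -- a point of `{c, d}` off `cl {a, b}`: the union has rank `≥ 3`
    have hout : ∃ e ∈ ({c, d} : Finset α), e ∉ clF M {a, b} := by
      by_contra hno
      push Not at hno
      exact hboth ⟨hno c (Finset.mem_insert_self _ _), hno d (Finset.mem_insert_of_mem (Finset.mem_singleton_self _))⟩
    obtain ⟨e, he, heF₁⟩ := hout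
    have heg : e ∈ gr M := (hpair _ _ hc hd) he
    have heF₂ : e ∈ clF M {c, d} := subset_clF_of_subset_gr (hpair _ _ hc hd) he
    have hrk3 : 3 ≤ rkN M (clF M {a, b} ∪ clF M {c, d}) := by
      have h := rkN_insert_of_notMem_clF (K := clF M {a, b}) heg (by rw [clF_clF]; exact heF₁)
      rw [rkN_clF, hs a (hQg ha) b (hQg hb) hab] at h
      have hsub : insert e (clF M {a, b}) ⊆ clF M {a, b} ∪ clF M {c, d} :=
        Finset.insert_subset (Finset.mem_union_right _ heF₂) Finset.subset_union_left
      have := rkN_mono (M := M) hsub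
      omega
    have hsm := rkN_submod (M := M) (clF M {a, b}) (clF M {c, d})
    rw [rkN_clF, rkN_clF, hs a (hQg ha) b (hQg hb) hab, hs c (hQg hc) d (hQg hd) hcd] at hsm
    have hIg : clF M {a, b} ∩ clF M {c, d} ⊆ gr M := fun v hv => mem_gr_of_mem_clF (Finset.mem_inter.1 hv).1
    have hwI : w ∈ clF M {a, b} ∩ clF M {c, d} := Finset.mem_inter.2 ⟨hw1, hw2⟩
    have hcommon : ∀ u : α, u ∈ Q' → u ∈ clF M {a, b} → u ∈ clF M {c, d} → False := by
      intro u hu hu1 hu2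
      have huw : u ≠ w := fun h => hwQ (h ▸ hu)
      have h2 := rkN_pair_eq_two hs hIg (Finset.mem_inter.2 ⟨hu1, hu2⟩) hwI huw
      omega
    by_cases haF₂ : a ∈ clF M {c, d}
    · exact hcommon a ha haF₁ haF₂
    by_cases hbF₂ : b ∈ clF M {c, d}
    · exact hcommon b hb hbF₁ hbF₂
    -- `a, b ∉ {c, d}`: four independent points, the union has rank `4`, the intersection rank `0`, but `w` is no loop
    have hac : a ≠ c := fun h => haF₂ (h ▸ hcF₂)
    have had : a ≠ d := fun h => haF₂ (h ▸ hdF₂)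
    have hbc : b ≠ c := fun h => hbF₂ (h ▸ hcF₂)
    have hbd : b ≠ d := fun h => hbF₂ (h ▸ hdF₂)
    have hsub4 : ({a, b, c, d} : Finset α) ⊆ Q' := by
      intro x hx
      simp only [Finset.mem_insert, Finset.mem_singleton] at hx
      rcases hx with rfl | rfl | rfl | rfl <;> assumption
    have hrk4 : rkN M {a, b, c, d} = 4 := by
      rw [rkN_eq_card_of_indep (hind.subset (by exact_mod_cast hsub4))]
      rw [Finset.card_insert_of_notMem, Finset.card_insert_of_notMem, Finset.card_pair hcd]
      · simp only [Finset.mem_insert, Finset.mem_singleton, not_or]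
        exact ⟨hbc, hbd⟩
      · simp only [Finset.mem_insert, Finset.mem_singleton, not_or]
        exact ⟨hab, hac, had⟩
    have hU : ({a, b, c, d} : Finset α) ⊆ clF M {a, b} ∪ clF M {c, d} := by
      intro x hx
      simp only [Finset.mem_insert, Finset.mem_singleton] at hx
      rw [Finset.mem_union]
      rcases hx with rfl | rfl | rfl | rfl
      · exact Or.inl haF₁
      · exact Or.inl hbF₁
      · exact Or.inr hcF₂
      · exact Or.inr hdF₂
    have hrkU := rkN_mono (M := M) hU
    rw [hrk4] at hrkU
    have hw1' : 1 ≤ rkN M (clF M {a, b} ∩ clF M {c, d}) := by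
      have h := rkN_singleton_of_indep (hl w hw)
      have hsub : ({w} : Finset α) ⊆ clF M {a, b} ∩ clF M {c, d} := Finset.singleton_subset_iff.2 hwI
      have := rkN_mono (M := M) hsub
      omega
    omega

omit [DecidableEq α] in
/-- **Packing, disjoint**: a family of pairwise disjoint subsets of `W` with `≥ m` points each has at most two members when
`|W| < 3m`: two members (possibly `∅`) cover the family. -/
theorem exists_two_cover_of_pairwise_disjoint [DecidableEq α] (W : Finset α) (𝓑 : Finset (Finset α)) (m : ℕ)
    (hsub : ∀ ℓ ∈ 𝓑, ℓ ⊆ W) (hdisj : ∀ ℓ ∈ 𝓑, ∀ ℓ' ∈ 𝓑, ℓ ≠ ℓ' → (ℓ ∩ ℓ').card = 0)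
    (hm : ∀ ℓ ∈ 𝓑, m ≤ ℓ.card) (hN : W.card < 3 * m) :
    ∃ ℓ₁ ℓ₂ : Finset α, (ℓ₁ ∈ 𝓑 ∨ ℓ₁ = ∅) ∧ (ℓ₂ ∈ 𝓑 ∨ ℓ₂ = ∅) ∧ ∀ ℓ ∈ 𝓑, ℓ = ℓ₁ ∨ ℓ = ℓ₂ := by
  by_cases h1 : 𝓑.Nonempty
  · obtain ⟨ℓ₁, hℓ₁⟩ := h1
    by_cases h2 : (𝓑.erase ℓ₁).Nonempty
    · obtain ⟨ℓ₂, hℓ₂'⟩ := h2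
      have hℓ₂ : ℓ₂ ∈ 𝓑 := Finset.mem_of_mem_erase hℓ₂'
      have h21 : ℓ₂ ≠ ℓ₁ := Finset.ne_of_mem_erase hℓ₂'
      refine ⟨ℓ₁, ℓ₂, Or.inl hℓ₁, Or.inl hℓ₂, ?_⟩
      intro ℓ hℓ
      by_contra hne
      push Not at hne
      have hA := Finset.card_union_add_card_inter ℓ₁ ℓ₂
      rw [hdisj ℓ₁ hℓ₁ ℓ₂ hℓ₂ (Ne.symm h21)] at hA
      have hB := Finset.card_union_add_card_inter (ℓ₁ ∪ ℓ₂) ℓ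
      have hI : ((ℓ₁ ∪ ℓ₂) ∩ ℓ).card = 0 := by
        rw [Finset.union_inter_distrib_right]
        have := Finset.card_union_le (ℓ₁ ∩ ℓ) (ℓ₂ ∩ ℓ)
        rw [hdisj ℓ₁ hℓ₁ ℓ hℓ (Ne.symm hne.1), hdisj ℓ₂ hℓ₂ ℓ hℓ (Ne.symm hne.2)] at this
        omega
      rw [hI] at hB
      have hW : ℓ₁ ∪ ℓ₂ ∪ ℓ ⊆ W := Finset.union_subset (Finset.union_subset (hsub ℓ₁ hℓ₁) (hsub ℓ₂ hℓ₂)) (hsub ℓ hℓ)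
      have := Finset.card_le_card hW
      have := hm ℓ₁ hℓ₁
      have := hm ℓ₂ hℓ₂
      have := hm ℓ hℓ
      omega
    · refine ⟨ℓ₁, ∅, Or.inl hℓ₁, Or.inr rfl, ?_⟩
      intro ℓ hℓ
      left
      by_contra hne
      exact h2 ⟨ℓ, Finset.mem_erase.2 ⟨hne, hℓ⟩⟩
  · refine ⟨∅, ∅, Or.inr rfl, Or.inr rfl, ?_⟩
    intro ℓ hℓ
    exact absurd ⟨ℓ, hℓ⟩ h1

omit [DecidableEq α] in
/-- **Packing, sharing at most one point**: a family of subsets of `W` pairwise sharing `≤ 1` point, with `≥ m` points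
each, has at most two members when `|W| + 3 < 3m`. -/
theorem exists_two_cover_of_pairwise_inter_le_one [DecidableEq α] (W : Finset α) (𝓒 : Finset (Finset α)) (m : ℕ)
    (hsub : ∀ C ∈ 𝓒, C ⊆ W) (hinter : ∀ C ∈ 𝓒, ∀ C' ∈ 𝓒, C ≠ C' → (C ∩ C').card ≤ 1)
    (hm : ∀ C ∈ 𝓒, m ≤ C.card) (hN : W.card + 3 < 3 * m) :
    ∃ C₁ C₂ : Finset α, (C₁ ∈ 𝓒 ∨ C₁ = ∅) ∧ (C₂ ∈ 𝓒 ∨ C₂ = ∅) ∧ ∀ C ∈ 𝓒, C = C₁ ∨ C = C₂ := by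
  by_cases h1 : 𝓒.Nonempty
  · obtain ⟨C₁, hC₁⟩ := h1
    by_cases h2 : (𝓒.erase C₁).Nonempty
    · obtain ⟨C₂, hC₂'⟩ := h2
      have hC₂ : C₂ ∈ 𝓒 := Finset.mem_of_mem_erase hC₂'
      have h21 : C₂ ≠ C₁ := Finset.ne_of_mem_erase hC₂'
      refine ⟨C₁, C₂, Or.inl hC₁, Or.inl hC₂, ?_⟩
      intro C hC
      by_contra hne
      push Not at hne
      have hA := Finset.card_union_add_card_inter C₁ C₂
      have hA' := hinter C₁ hC₁ C₂ hC₂ (Ne.symm h21)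
      have hB := Finset.card_union_add_card_inter (C₁ ∪ C₂) C
      have hI : ((C₁ ∪ C₂) ∩ C).card ≤ 2 := by
        rw [Finset.union_inter_distrib_right]
        have := Finset.card_union_le (C₁ ∩ C) (C₂ ∩ C)
        have := hinter C₁ hC₁ C hC (Ne.symm hne.1)
        have := hinter C₂ hC₂ C hC (Ne.symm hne.2)
        omega
      have hW : C₁ ∪ C₂ ∪ C ⊆ W := Finset.union_subset (Finset.union_subset (hsub C₁ hC₁) (hsub C₂ hC₂)) (hsub C hC)
      have := Finset.card_le_card hW
      have := hm C₁ hC₁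
      have := hm C₂ hC₂
      have := hm C hC
      omega
    · refine ⟨C₁, ∅, Or.inl hC₁, Or.inr rfl, ?_⟩
      intro C hC
      left
      by_contra hne
      exact h2 ⟨C, Finset.mem_erase.2 ⟨hne, hC⟩⟩
  · refine ⟨∅, ∅, Or.inr rfl, Or.inr rfl, ?_⟩
    intro C hC
    exact absurd ⟨C, hC⟩ h1

omit [DecidableEq α] in
/-- **Packing, one member**: a family of subsets of `W` pairwise sharing `≤ 1` point, with `≥ m` points each, has at
most one member when `|W| + 1 < 2m`. -/
theorem exists_one_cover_of_pairwise_inter_le_one [DecidableEq α] (W : Finset α) (𝓒 : Finset (Finset α)) (m : ℕ)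
    (hsub : ∀ C ∈ 𝓒, C ⊆ W) (hinter : ∀ C ∈ 𝓒, ∀ C' ∈ 𝓒, C ≠ C' → (C ∩ C').card ≤ 1)
    (hm : ∀ C ∈ 𝓒, m ≤ C.card) (hN : W.card + 1 < 2 * m) :
    ∃ C₁ : Finset α, (C₁ ∈ 𝓒 ∨ C₁ = ∅) ∧ ∀ C ∈ 𝓒, C = C₁ := by
  by_cases h1 : 𝓒.Nonempty
  · obtain ⟨C₁, hC₁⟩ := h1
    refine ⟨C₁, Or.inl hC₁, ?_⟩
    intro C hC
    by_contra hne
    have hA := Finset.card_union_add_card_inter C₁ C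
    have hA' := hinter C₁ hC₁ C hC (Ne.symm hne)
    have hW : C₁ ∪ C ⊆ W := Finset.union_subset (hsub C₁ hC₁) (hsub C hC)
    have := Finset.card_le_card hW
    have := hm C₁ hC₁
    have := hm C hC
    omega
  · refine ⟨∅, Or.inr rfl, ?_⟩
    intro C hC
    exact absurd ⟨C, hC⟩ h1

end PercRepro.Shadow
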